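import Literature.NumberTheory.Automorphic.AutomorphicRepsGLCuspidalL2FourLeaves
import Literature.NumberTheory.Automorphic.HarishChandraFinitenessGLCuspidal
import HarnessLib

/-!
# Step 3a of Borel–Jacquet 4.6 for `GL_n` holds: discharge of
# `AutomorphicRepsGL.formsOfL2_closure_exp_invariant`, of `AutomorphicRepsGL.cuspidal_closure_exp_invariant`
# and of `AutomorphicRepsGL.formsOfL2_coeff_analyticAt`

Topic `NumberTheory/Automorphic`; sibling proof file of `AutomorphicRepsGLCuspidalL2Step3` (which
decomposes Step 3 of Borel–Jacquet 1979, 4.6 for `GL_n` — the irreducibility of the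
`(𝔤, K_∞) × GL_n(𝔸_K^∞)`-module `V_Π = formsOfL2 hcpt μ Π` of an irreducible closed invariant
`Π ≤ L²_cusp(GL_n(𝔸_K) ⧸ A_G GL_n(K), μ)` — into the two halves F3a, F3b of Harish-Chandra's
correspondence and proves the assembly `formsOfL2_irreducible_of`) and of
`AutomorphicRepsGLIrreducibleL2Proofs` (named fact `AutomorphicRepsGL.cuspidal_closure_exp_invariant
hcpt μ`, the same closure statement for every stable space of `A_G`-invariant cusp forms).

F3a, `AutomorphicRepsGL.formsOfL2_closure_exp_invariant hcpt μ`, says: for a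
`(𝔤, K_∞) × GL_n(𝔸_K^∞)`-stable `W ≤ V_Π` and `X ∈ 𝔤 = 𝔤𝔩_n(K_∞)`, the `L²`-closure of the classes
`[W] = l2OfForms W` is invariant under `R(exp X)`. In print this is the clause "since every element in
`V'` is well-behaved, `V = Cl(V')` is invariant under `π(G)`" of the proof of Harish-Chandra 1953,
Thm. 5 (p. 229), i.e. the Corollary to Thm. 2 (p. 211: `Cl(π_W(𝔅)ψ)` is `π(G)`-invariant for a
well-behaved `ψ` — the coefficient `x ↦ φ(π(x)ψ₀)` is analytic with all derivatives at `1` equal to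
values of `φ` on `π_W(𝔅)ψ₀`, hence vanishes when `φ ⊥ U`, and Hahn–Banach) fed with Lemma 34 (p. 228:
`K`-finite vectors are well-behaved when `dim ℌ_𝔇 < ∞`).

The tree proves every ingredient: the closure argument along `exp tX`
(`cuspidal_closure_exp_invariant_of_analytic`, `AutomorphicRepsGLIrreducibleL2HC`: Taylor expansion,
identity principle, double orthogonal complement), the analyticity of the `L²`-orbits
`t ↦ R(exp tX)[f]` of classes of `K`-finite `Z(𝔤)`-finite cusp forms by Nelson's method
(`cuspidal_analyticAt_rightRegular_of_bounded`, `AutomorphicRepsGLAnalyticVectorsHolds`, whence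
`formsOfL2_closure_exp_invariant_of_bounded` on the base `{cuspidal_bounded}`), and the boundedness
of `A_G`-invariant cusp forms (`AutomorphicRepsGL.cuspidal_bounded_holds`, `CuspFormsBoundedHC`:
uniform moderate growth by the `L²` compactness route, rapid decay, reduction theory). Hence:

* `AutomorphicRepsGL.formsOfL2_closure_exp_invariant_holds` — **F3a holds** (discharge);
* `AutomorphicRepsGL.cuspidal_closure_exp_invariant_holds` — **Harish-Chandra's closure theorem for
  stable spaces of `A_G`-invariant cusp forms holds** (discharge);
* `AutomorphicRepsGL.formsOfL2_coeff_analyticAt_holds` — **the weak form of Harish-Chandra's Lemma 34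
  for cuspidal `Π` holds** (discharge of the named fact of `AutomorphicRepsGLClosureAnalytic`, the
  earlier decomposition child of F3a: for `invQuot f ∈ V_Π`, `X ∈ 𝔤`, `u ∈ L²`, the coefficient
  `t ↦ ⟪u, R(exp tX)[f]⟫` is real analytic at `0`): `invQuot f` lies in the STABLE space
  `𝒜₀ ⊓ bddInvariant` of all `A_G`-invariant cusp forms (`isStableSubmodule_cuspFormsGL_inf_bddInvariant`,
  `HarishChandraFinitenessGLCuspidal`), whose `L²`-orbits are analytic
  (`cuspidal_analyticAt_rightRegular_of_bounded`), and `v ↦ ⟪u, v⟫` is a continuous linear form;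
* the reductions of `AutomorphicRepsGLCuspidalL2Step3` / `…Step3b` / `…IrreducibleL2HC` with these
  hypotheses removed: `AutomorphicRepsGL.formsOfL2_closure_invariant` (the closure of `[W]`, `W ≤ V_Π`
  stable, is `GL_n(𝔸_K)`-invariant), `AutomorphicRepsGL.formsOfL2_irreducible_of_F3b` (Step 3 from
  F3b alone), `AutomorphicRepsGL.formsOfL2_irreducible_of_isAdmissibleGK'` (Step 3 from the
  admissibility of the `Π^U` alone — Harish-Chandra's Thm. 5 as printed),
  `AutomorphicRepsGL.exists_cuspidalRepData_of_L2_of_F1_F2_F3b` and `…_of_F1_F2_adm` (the root fact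
  of Borel–Jacquet 4.6 from F1, F2 and F3b, resp. admissibility),
  `AutomorphicRepsGL.cuspidal_closure_irreducible_of_exists_mem` and
  `AutomorphicRepsGL.exists_le_formsOfL2_of_W'_eq_bot_of_exists_mem` (the realisation of irreducible
  spaces of cusp forms in `L²_cusp` on the single base `{cuspidal_closure_exists_mem_l2OfForms}`),
  `AutomorphicRepsGL.exists_cuspidalRepData_of_L2_of_F1d_HC_F3b` (the root fact from the three open
  leaves F1d, `φ = φ ∗ α`, F3b of `exists_cuspidalRepData_of_L2_of_five`, `…CuspidalL2Frontier`).

The file cannot be merged into `AutomorphicRepsGLCuspidalL2Step3` (its inputs import that module).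
Nothing is defined or restated here; no named fact is introduced.

## References

* Harish-Chandra, *Representations of a semisimple Lie group on a Banach space. I*, Trans. AMS 75
  (1953), 185–243: Cor. to Thm. 2 (p. 211), Lemma 34 and Thm. 5 (pp. 228–229)
  [HarishChandraTAMS1953] (held: doi 10.1090/s0002-9947-1953-0056610-2, PDF pp. 27, 44–45).
* A. Borel, H. Jacquet, *Automorphic forms and automorphic representations*, Proc. Sympos. Pure
  Math. 33 (Corvallis 1977), Part 1 (1979), 189–202, §4.6 [BorelJacquetCorvallis1979] (not held).
* M. Libine, *Introduction to Representations of Real Semisimple Lie Groups*, arXiv:1212.2578,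
  Cor. 73, Lemma 74, Cor. 75 [Libine2012] (held).
* J. R. Getz, H. Hahn, *An Introduction to Automorphic Representations*, GTM 300 (2024), Thm. 6.5.2
  (p. 121), Thm. 9.8.1 [GetzHahn2024] (held).
-/

noncomputable section

-- (H5) `Classical`: the index types of `K_∞ = mixedSpace K` are `Fintype` classically, which the
-- normed-ring structure of `K_∞` behind `AutomorphyDatum.gl` needs (as in `…CuspidalL2Step3`).
open scoped MatrixGroups Classical
open NumberField _root_.MeasureTheory

namespace Literature.NumberTheory.Automorphic

variable {n : ℕ} {K : Type} [Field K] [NumberField K]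
  {hcpt : isCompact_glFiniteIntegralLevel n K}
  {μ : Measure (AdelicGroupData.gl n K).automorphicQuotient}
  [(AdelicGroupData.gl n K).IsAutomorphicMeasure μ]

/-! ## The two discharges -/

variable (hcpt μ) in
/-- **F3a holds (Step 3a of Borel–Jacquet 4.6 for `GL_n`).** For an irreducible closed invariant
`Π ≤ L²_cusp(GL_n(𝔸_K) ⧸ A_G GL_n(K), μ)`, a `(𝔤, K_∞) × GL_n(𝔸_K^∞)`-stable `W ≤ V_Π` and
`X ∈ 𝔤𝔩_n(K_∞)`, the `L²`-closure of the classes of `W` is invariant under `R(exp X)`: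
`formsOfL2_closure_exp_invariant_of_bounded` (analyticity of the `L²`-orbits of cusp forms by
Nelson's method, then the Corollary to Thm. 2 along `exp tX`) with the proved boundedness of
`A_G`-invariant cusp forms `cuspidal_bounded_holds`. Harish-Chandra 1953, Cor. to Thm. 2 (p. 211)
with Lemma 34 and the proof of Thm. 5 (p. 229); Borel–Jacquet 1979, 4.6.
[cite: HarishChandraTAMS1953, Cor. to Thm. 2 (p. 211) and Thm. 5 (pp. 228–229)] -/
theorem AutomorphicRepsGL.formsOfL2_closure_exp_invariant_holds :
    AutomorphicRepsGL.formsOfL2_closure_exp_invariant hcpt μ :=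
  AutomorphicRepsGL.formsOfL2_closure_exp_invariant_of_bounded AutomorphicRepsGL.cuspidal_bounded_holds

variable (hcpt μ) in
/-- **Harish-Chandra's closure theorem for cusp forms on `GL_n` holds.** For every
`(𝔤, K_∞) × GL_n(𝔸_K^∞)`-stable space `W` of `A_G`-invariant cusp forms and `X ∈ 𝔤𝔩_n(K_∞)`, the
`L²`-closure of the classes `[W]` is invariant under `R(exp X)`
(`cuspidal_closure_exp_invariant_of_bounded` with `cuspidal_bounded_holds`).
Harish-Chandra 1953, Cor. to Thm. 2 (p. 211) with Lemma 34. [cite: HarishChandraTAMS1953, Cor. to Thm. 2 (p. 211)] -/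
theorem AutomorphicRepsGL.cuspidal_closure_exp_invariant_holds :
    AutomorphicRepsGL.cuspidal_closure_exp_invariant hcpt μ :=
  AutomorphicRepsGL.cuspidal_closure_exp_invariant_of_bounded AutomorphicRepsGL.cuspidal_bounded_holds

/-! ## Step 3 of Borel–Jacquet 4.6 with F3a discharged -/

/-- **The closure of the classes of a stable `W ≤ V_Π` is `GL_n(𝔸_K)`-invariant**, unconditionally
(`formsOfL2_closure_invariant_of` with F3a discharged: `g = (g_∞, 1)(1, g_f)`, `g_∞ = k exp X` by
the polar decomposition, each factor preserving the closure). Harish-Chandra 1953, Thm. 5 (p. 229);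
Libine 2012, Cor. 73; Borel–Jacquet 1979, 4.6. [cite: HarishChandraTAMS1953, Thm. 5 (pp. 228–229)] -/
theorem AutomorphicRepsGL.formsOfL2_closure_invariant (P : CuspidalAutomorphicRepGL n K μ)
    {W : Submodule ℂ ((AdelicGroupData.gl n K).Adelic → ℂ)} (hWV : W ≤ formsOfL2 hcpt μ P.1)
    (hW : IsStableSubmodule (AutomorphyDatum.gl n K hcpt) W) (g : (AdelicGroupData.gl n K).Adelic)
    {y : (AdelicGroupData.gl n K).L2 μ}
    (hy : y ∈ (l2OfForms (AdelicGroupData.gl n K) μ W).topologicalClosure) :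
    (AdelicGroupData.gl n K).rightRegular μ g y ∈
      (l2OfForms (AdelicGroupData.gl n K) μ W).topologicalClosure :=
  AutomorphicRepsGL.formsOfL2_closure_invariant_of
    (AutomorphicRepsGL.formsOfL2_closure_exp_invariant_holds hcpt μ) P hWV hW g hy

/-- **Step 3 of Borel–Jacquet 4.6 for `GL_n` from F3b alone**: the `(𝔤, K_∞) × GL_n(𝔸_K^∞)`-module
`V_Π` of an irreducible closed invariant `Π ≤ L²_cusp` is irreducible, granted only the `K`-finite
half `formsOfL2_mem_of_toLp_mem_closure hcpt μ` of Harish-Chandra's correspondence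
(`formsOfL2_irreducible_of` with F3a discharged). Harish-Chandra 1953, Thm. 5; Libine 2012, Cor. 75.
[cite: HarishChandraTAMS1953, Thm. 5 (pp. 228–229)] -/
theorem AutomorphicRepsGL.formsOfL2_irreducible_of_F3b
    (h₃b : AutomorphicRepsGL.formsOfL2_mem_of_toLp_mem_closure hcpt μ) :
    AutomorphicRepsGL.formsOfL2_irreducible hcpt μ :=
  AutomorphicRepsGL.formsOfL2_irreducible_of
    (AutomorphicRepsGL.formsOfL2_closure_exp_invariant_holds hcpt μ) h₃b

/-- **Harish-Chandra's Theorem 5 for cuspidal `Π` on `GL_n`, as printed**: if `K_∞` acts with finite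
multiplicities on every `Π^U` (`isAdmissibleGK_cuspidal_levelFixed hcpt μ`, the hypothesis
`dim ℌ_𝔇 < ∞` of Thm. 5), then `V_Π` is an irreducible `(𝔤, K_∞) × GL_n(𝔸_K^∞)`-module
(`formsOfL2_irreducible_of_isAdmissibleGK` with F3a discharged). Harish-Chandra 1953, Thm. 5
(p. 228); Libine 2012, Lemma 74 and Cor. 75. [cite: HarishChandraTAMS1953, Thm. 5 (pp. 228–229)] -/
theorem AutomorphicRepsGL.formsOfL2_irreducible_of_isAdmissibleGK'
    (hadm : AutomorphicRepsGL.isAdmissibleGK_cuspidal_levelFixed hcpt μ) :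
    AutomorphicRepsGL.formsOfL2_irreducible hcpt μ :=
  AutomorphicRepsGL.formsOfL2_irreducible_of_isAdmissibleGK
    (AutomorphicRepsGL.formsOfL2_closure_exp_invariant_holds hcpt μ) hadm

/-- **Borel–Jacquet 4.6 for `GL_n` from F1, F2 and F3b** (F3a discharged here, F4 in
`AutomorphicRepsGLCuspidalL2Step4`): every irreducible closed invariant `Π ≤ L²_cusp` comes from the
cuspidal automorphic representation datum `V_Π / 0`. Borel–Jacquet 1979, 4.6. [cite: BorelJacquetCorvallis1979, 4.6] -/
theorem AutomorphicRepsGL.exists_cuspidalRepData_of_L2_of_F1_F2_F3b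
    (h₁ : AutomorphicRepsGL.formsOfL2_ne_bot hcpt μ)
    (h₂ : AutomorphicRepsGL.formsOfL2_isStableSubmodule hcpt μ)
    (h₃b : AutomorphicRepsGL.formsOfL2_mem_of_toLp_mem_closure hcpt μ) :
    AutomorphicRepsGL.exists_cuspidalRepData_of_L2 hcpt μ :=
  AutomorphicRepsGL.exists_cuspidalRepData_of_L2_of_F1_F2_F3ab h₁ h₂
    (AutomorphicRepsGL.formsOfL2_closure_exp_invariant_holds hcpt μ) h₃b

/-- **Borel–Jacquet 4.6 for `GL_n` from F1, F2 and the admissibility of the `Π^U`**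
(`exists_cuspidalRepData_of_L2_of_F1_F2_F3a_adm` with F3a discharged). Borel–Jacquet 1979, 4.6;
Getz–Hahn 2024, Thm. 6.5.2. [cite: BorelJacquetCorvallis1979, 4.6] -/
theorem AutomorphicRepsGL.exists_cuspidalRepData_of_L2_of_F1_F2_adm
    (h₁ : AutomorphicRepsGL.formsOfL2_ne_bot hcpt μ)
    (h₂ : AutomorphicRepsGL.formsOfL2_isStableSubmodule hcpt μ)
    (hadm : AutomorphicRepsGL.isAdmissibleGK_cuspidal_levelFixed hcpt μ) :
    AutomorphicRepsGL.exists_cuspidalRepData_of_L2 hcpt μ :=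
  AutomorphicRepsGL.exists_cuspidalRepData_of_L2_of_F1_F2_F3a_adm h₁ h₂
    (AutomorphicRepsGL.formsOfL2_closure_exp_invariant_holds hcpt μ) hadm

/-! ## The realisation of irreducible spaces of cusp forms in `L²_cusp` with boundedness discharged -/

/-- **Closed invariant subspaces of `Cl[W]` are `⊥` or contain `[W]`** (`W` an irreducible stable
space of `A_G`-invariant cusp forms), granted only the `K`-finite half
`cuspidal_closure_exists_mem_l2OfForms hcpt μ` (`cuspidal_closure_irreducible_of` with
`cuspidal_bounded_holds`). Harish-Chandra 1953, Thm. 5 (pp. 228–229). [cite: HarishChandraTAMS1953, Thm. 5 (pp. 228–229)] -/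
theorem AutomorphicRepsGL.cuspidal_closure_irreducible_of_exists_mem
    (h : AutomorphicRepsGL.cuspidal_closure_exists_mem_l2OfForms hcpt μ) :
    AutomorphicRepsGL.cuspidal_closure_irreducible hcpt μ :=
  AutomorphicRepsGL.cuspidal_closure_irreducible_of AutomorphicRepsGL.cuspidal_bounded_holds h

/-- **An irreducible stable space of `A_G`-invariant cusp forms on `GL_n(𝔸_K)` lies in some `V_Π`**,
`Π ≤ L²_cusp` irreducible closed invariant, granted only `cuspidal_closure_exists_mem_l2OfForms hcpt μ`
(`exists_le_formsOfL2_of_W'_eq_bot_of_bounded_of_exists_mem` with `cuspidal_bounded_holds`).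
Borel–Jacquet 1979, 4.6; Harish-Chandra 1953, Cor. to Thm. 2 and Thm. 5. [cite: BorelJacquetCorvallis1979, 4.6] -/
theorem AutomorphicRepsGL.exists_le_formsOfL2_of_W'_eq_bot_of_exists_mem
    (h : AutomorphicRepsGL.cuspidal_closure_exists_mem_l2OfForms hcpt μ) :
    AutomorphicRepsGL.exists_le_formsOfL2_of_W'_eq_bot hcpt μ :=
  AutomorphicRepsGL.exists_le_formsOfL2_of_W'_eq_bot_of_bounded_of_exists_mem
    AutomorphicRepsGL.cuspidal_bounded_holds h

/-- **`exists_isAssociatedL2` on the base `{cuspidal_W'_eq_bot, cuspidal_closure_exists_mem_l2OfForms,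
formsOfL2_mem_of_toLp_mem_closure}`** (`exists_isAssociatedL2_of_bounded_of_exists_mem` with
boundedness discharged and F3 from F3b). Borel–Jacquet 1979, 4.4–4.6. [cite: BorelJacquetCorvallis1979, 4.4–4.6] -/
theorem AutomorphicRepsGL.exists_isAssociatedL2_of_exists_mem_of_F3b
    (hss : cuspidal_W'_eq_bot hcpt)
    (h : AutomorphicRepsGL.cuspidal_closure_exists_mem_l2OfForms hcpt μ)
    (h₃b : AutomorphicRepsGL.formsOfL2_mem_of_toLp_mem_closure hcpt μ) :
    AutomorphicRepsGL.exists_isAssociatedL2 hcpt μ :=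
  AutomorphicRepsGL.exists_isAssociatedL2_of_bounded_of_exists_mem hss
    AutomorphicRepsGL.cuspidal_bounded_holds h (AutomorphicRepsGL.formsOfL2_irreducible_of_F3b h₃b)

/-! ## Harish-Chandra's Lemma 34 for cuspidal `Π`, weak form: `formsOfL2_coeff_analyticAt` holds -/

variable (hcpt μ) in
/-- **The matrix coefficients of `K`-finite vectors of cuspidal `Π` are real analytic along the
one-parameter subgroups** — the named fact `AutomorphicRepsGL.formsOfL2_coeff_analyticAt hcpt μ` of
`AutomorphicRepsGLClosureAnalytic`, DISCHARGED: for an irreducible closed invariant `Π ≤ L²_cusp`,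
`f ∈ ℒ²(μ)` with `invQuot f ∈ V_Π`, `X ∈ 𝔤𝔩_n(K_∞)` and `u ∈ L²(μ)`, `t ↦ ⟪u, R(exp tX)[f]⟫` is real
analytic at `t = 0`. Proof: `invQuot f` is an `A_G`-invariant cusp form
(`formsOfL2_le_cuspFormsGL`, `formsOfL2_center'_invariant`), i.e. an element of the
`(𝔤, K_∞) × GL_n(𝔸_K^∞)`-stable space `𝒜₀ ⊓ bddInvariant`
(`isStableSubmodule_cuspFormsGL_inf_bddInvariant`); the `L²`-orbit `t ↦ R(exp tX)[f]` of such a class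
is real analytic (`cuspidal_analyticAt_rightRegular_of_bounded`, Nelson's method, with
`cuspidal_bounded_holds`), and `v ↦ ⟪u, v⟫` is a continuous linear form. Harish-Chandra 1953,
Lemma 34 (p. 228) with §7 (p. 209); Libine 2012, Thm. 72. [cite: HarishChandraTAMS1953, Lemma 34 (p. 228)] -/
theorem AutomorphicRepsGL.formsOfL2_coeff_analyticAt_holds :
    AutomorphicRepsGL.formsOfL2_coeff_analyticAt hcpt μ := by
  intro P f hf hfV X u
  -- `invQuot f` lies in the stable space of all `A_G`-invariant cusp forms
  have hmem : invQuot (AdelicGroupData.gl n K) f ∈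
      cuspFormsGL n K hcpt ⊓ (AdelicGroupData.gl n K).bddInvariant :=
    mem_cuspFormsGL_inf_bddInvariant_iff.2
      ⟨AutomorphicRepsGL.formsOfL2_le_cuspFormsGL P.le_cuspidalSubspace hfV,
        fun z hz g ↦ formsOfL2_center'_invariant P.1 hfV hz g⟩
  -- its `L²`-orbit along `exp tX` is real analytic (Nelson), in particular at `t = 0`
  have horb := AutomorphicRepsGL.cuspidal_analyticAt_rightRegular_of_bounded (μ := μ)
    AutomorphicRepsGL.cuspidal_bounded_holds _ isStableSubmodule_cuspFormsGL_inf_bddInvariant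
    inf_le_left (fun φ hφ ↦ (mem_cuspFormsGL_inf_bddInvariant_iff.1 hφ).2) X f hf hmem 0
  -- compose with the continuous (real-)linear form `v ↦ ⟪u, v⟫`
  have h := (((innerSL ℂ u).restrictScalars ℝ).analyticAt _).comp horb
  simpa only [Function.comp_def, ContinuousLinearMap.coe_restrictScalars', innerSL_apply_apply] using h

/-- **Borel–Jacquet 1979, 4.6 for `GL_n` from its three open leaves** F1d (the infinitesimal
character of `Z(𝔤)` on the Gårding vectors of the irreducible `Π`), Harish-Chandra's convolution
identity `φ = φ ∗ α` and F3b (`Cl[W] ∩ V_Π = W`): `exists_cuspidalRepData_of_L2_of_five`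
(`AutomorphicRepsGLCuspidalL2Frontier`) with boundedness and the analyticity of the coefficients
discharged. Borel–Jacquet 1979, 4.6; Getz–Hahn 2024, Thm. 6.5.2. [cite: BorelJacquetCorvallis1979, 4.6] -/
theorem AutomorphicRepsGL.exists_cuspidalRepData_of_L2_of_F1d_HC_F3b
    (h1d : AutomorphicRepsGL.exists_infinitesimalCharacter_garding hcpt μ)
    (hHC : AutomorphicRepsGL.exists_convolution_eq_self hcpt)
    (h3b : AutomorphicRepsGL.formsOfL2_mem_of_toLp_mem_closure hcpt μ) :
    AutomorphicRepsGL.exists_cuspidalRepData_of_L2 hcpt μ :=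
  AutomorphicRepsGL.exists_cuspidalRepData_of_L2_of_five h1d hHC AutomorphicRepsGL.cuspidal_bounded_holds
    (AutomorphicRepsGL.formsOfL2_coeff_analyticAt_holds hcpt μ) h3b

end Literature.NumberTheory.Automorphic
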